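import Literature.Geometry.Lorentzian.CoordRicciCovariantIter
import Literature.Analysis.Calculus.EvolutionDerivBoundsIntegrable
import HarnessLib

/-!
# Identities for the scaled metric `G/(T − t)` along a coordinate Ricci flow

Coordinate support for the `C^∞` convergence of the NORMALISED metrics `g̃(t) = g(t)/(T − t)` at
a round singular time (Hamilton 1982, §14, Lemma 14.2 and §17, Cor. 17.10: bounds on all
derivatives of `g̃_{ij}` in charts, and their uniform Cauchy property as `t ↑ T`, from the decay of
the Einstein defect `Ric − g/(2(T − t))` and of the covariant derivatives `∇ᵏRic`, by the
induction on the order of Chow–Knopf 2004, §6.7 with integrable instead of bounded rates). For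
metric components `G` (`IsMetricOn G V`, a basis `b`) and a family `G : ℝ → …`
(`IsMetricFamilyOn G (Ico 0 T) V`) solving `∂ₜG = −2 Ric(G)`:

* `inverse_const_smul` — `(c • A)⁻¹ = c⁻¹ • A⁻¹`: the inverse of the scaled metric
  `G̃ = (T − t)⁻¹ G` is `(T − t) G⁻¹`.
* `IsMetricOn.fderiv_ric2_sub_apply_basis` — the coordinate derivative of the components of a
  defect `D = Ric − c g` (`c` a constant): `∂_j D_I = (∇Ric)_{jI} + Σ_a Σ_m Γ^m_{jI_a} D_{I[a↦m]}`
  (`∇g = 0`, so `∇D = ∇Ric`; from `tcov_apply_ocons` and `fderiv_metric_apply_basis`).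
* `IsMetricFamilyOn.deriv_inv_smul_of_flow` — the scaled flow equation
  `∂ₜ ((T − t)⁻¹ G) = −2 (T − t)⁻¹ (Ric(G) − (2(T − t))⁻¹ G)` at interior times.
* bookkeeping for decay weights `(T − t)^{−δ}` in the classes `SpatiallyBddUpTo` of
  `EvolutionDerivBoundsGraded.lean`: `spatiallyBddUpTo_zero_rpow_neg_smul` (order zero from a
  pointwise decay bound `‖u‖ ≤ C (T − t)^δ`) and `exists_pos_le_forall_le` (a common positive rate
  below finitely many rates).

Everything here is proved; no named fact.

## References

* R. S. Hamilton, *Three-manifolds with positive Ricci curvature*, J. Differential Geom. 17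
  (1982) 255–306, §14, Lemma 14.2; §17, Cor. 17.10. [Hamilton1982]
* B. Chow, D. Knopf, *The Ricci flow: an introduction*, AMS 2004, §6.7. [ChowKnopf2004]
* P. Topping, *Lectures on the Ricci flow*, LMS Lecture Note Series 325, CUP 2006, Prop. 2.3.1,
  §5.3 (pp. 47–48). [Topping2006]
-/

noncomputable section

set_option maxSynthPendingDepth 3

open Set Filter ContinuousLinearMap Module Function
open scoped Topology ContDiff

namespace Literature.Geometry.Lorentzian

namespace MetricCoord

open Literature.Analysis.Calculus

variable {E : Type*} [NormedAddCommGroup E] [NormedSpace ℝ E] {ι : Type*}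

/-! ### The inverse of a scaled form -/

/-- **Inverse of a scaled map**: `(c • A)⁻¹ = c⁻¹ • A⁻¹` for `c ≠ 0` and `A` invertible (so the
inverse metric of `G̃ = (T − t)⁻¹ G` is `(T − t) G⁻¹`). [folklore] -/
theorem inverse_const_smul {F : Type*} [NormedAddCommGroup F] [NormedSpace ℝ F] {A : E →L[ℝ] F}
    (hA : A.IsInvertible) {c : ℝ} (hc : c ≠ 0) : (c • A).inverse = c⁻¹ • A.inverse := by
  apply ContinuousLinearMap.inverse_eq
  · rw [ContinuousLinearMap.smul_comp, ContinuousLinearMap.comp_smul, smul_smul,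
      mul_inv_cancel₀ hc, one_smul, hA.self_comp_inverse]
  · rw [ContinuousLinearMap.smul_comp, ContinuousLinearMap.comp_smul, smul_smul,
      inv_mul_cancel₀ hc, one_smul, hA.inverse_comp_self]

/-! ### The coordinate derivative of a defect `Ric − c g` -/

section Defect

variable [Fintype ι] [CompleteSpace E] [FiniteDimensional ℝ E]
  {G : E → E →L[ℝ] E →L[ℝ] ℝ} {b : Basis ι ℝ E} {V : Set E} {x : E}

/-- **Coordinate derivative of the components of `D = Ric − c g`** (`c` constant): since
`∇g = 0`, `∂_j D_I = (∇Ric)_{jI} + Σ_a Σ_m Γ^m_{j I_a} D_{I[a ↦ m]}`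
(`tcov_apply_ocons` for `Ric` and `fderiv_metric_apply_basis` for `g`).
[cite: ONeill1983, Ch. 2, Prop. 2.13] -/
theorem IsMetricOn.fderiv_ric2_sub_apply_basis (hG : IsMetricOn G V) (hx : x ∈ V) (c : ℝ) (j : ι)
    (I : Fin 2 → ι) :
    fderiv ℝ (fun y ↦ ric2 G b y I - c * G y (b (I 0)) (b (I 1))) x (b j) =
      tcov G b (ric2 G b) x (ocons j I) +
        ∑ a, ∑ m, chrCoef G b x j (I a) m *
          (ric2 G b x (update I a m) - c * G x (b (update I a m 0)) (b (update I a m 1))) := by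
  have hR : DifferentiableAt ℝ (fun y ↦ ric2 G b y I) x :=
    (hG.tsmoothOn_ric2 (b := b)).differentiableAt hG.isOpen hx I
  have hGc : DifferentiableAt ℝ (fun y ↦ G y (b (I 0)) (b (I 1))) x :=
    differentiableAt_clm_apply_const
      (differentiableAt_clm_apply_const (hG.differentiableAt hx) (b (I 0))) (b (I 1))
  rw [fderiv_fun_sub hR (hGc.const_mul c), fderiv_const_mul hGc]
  simp only [_root_.sub_apply, _root_.smul_apply, smul_eq_mul]
  rw [tcov_apply_ocons, hG.fderiv_metric_apply_basis hx j (I 0) (I 1)]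
  simp only [Fin.sum_univ_two, update_self, update_of_ne (show (1 : Fin 2) ≠ 0 by decide),
    update_of_ne (show (0 : Fin 2) ≠ 1 by decide)]
  have h : ∑ m, chrCoef G b x j (I 0) m * (ric2 G b x (update I 0 m) - c * G x (b m) (b (I 1))) +
      ∑ m, chrCoef G b x j (I 1) m * (ric2 G b x (update I 1 m) - c * G x (b (I 0)) (b m)) =
      (∑ m, chrCoef G b x j (I 0) m * ric2 G b x (update I 0 m) +
        ∑ m, chrCoef G b x j (I 1) m * ric2 G b x (update I 1 m)) -
      c * ∑ m, (chrCoef G b x j (I 0) m * G x (b m) (b (I 1)) +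
        chrCoef G b x j (I 1) m * G x (b (I 0)) (b m)) := by
    rw [Finset.mul_sum, ← Finset.sum_add_distrib, ← Finset.sum_add_distrib,
      ← Finset.sum_sub_distrib]
    exact Finset.sum_congr rfl fun m _ ↦ by ring
  rw [h]
  ring

end Defect

/-! ### The scaled flow equation -/

section Scaled

variable [FiniteDimensional ℝ E] {G : ℝ → E → E →L[ℝ] E →L[ℝ] ℝ} {V : Set E} {T : ℝ}

/-- **The flow equation for the scaled metric** `G̃ = (T − t)⁻¹ G` at interior times: from
`∂ₜG = −2 Ric(G)` on `V × [0, T)`,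
`∂ₜ G̃ = (T − t)⁻² G − 2(T − t)⁻¹ Ric(G) = −2 (T − t)⁻¹ (Ric(G) − (2(T − t))⁻¹ G)` (Hamilton 1982,
§17: the normalised equation has the defect `Ric(g̃) − g̃/2` on its right-hand side).
[cite: Hamilton1982, §17, Cor. 17.10] -/
theorem IsMetricFamilyOn.deriv_inv_smul_of_flow (hG : IsMetricFamilyOn G (Ico 0 T) V)
    (hfl : ∀ s ∈ Ico 0 T, ∀ y ∈ V, tDeriv G (Ico 0 T) s y = (-2 : ℝ) • ricAt (G s) y)
    {t : ℝ} (ht : t ∈ Ioo 0 T) {y : E} (hy : y ∈ V) :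
    deriv (fun s ↦ (T - s)⁻¹ • G s y) t =
      (-2 * (T - t)⁻¹) • (ricAt (G t) y - (2 * (T - t))⁻¹ • G t y) := by
  have hTt : T - t ≠ 0 := sub_ne_zero.2 (ne_of_gt ht.2)
  have htI : t ∈ Ico 0 T := ⟨ht.1.le, ht.2⟩
  have h1 : HasDerivAt (fun s : ℝ ↦ (T - s)⁻¹) (-(0 - 1) / (T - t) ^ 2) t :=
    ((hasDerivAt_const t T).sub (hasDerivAt_id t)).inv hTt
  have h2 : HasDerivAt (fun s ↦ G s y) ((-2 : ℝ) • ricAt (G t) y) t := by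
    have h := (hG.hasDerivWithinAt hy htI).hasDerivAt (Ico_mem_nhds ht.1 ht.2)
    rwa [hfl t htI y hy] at h
  have h3 : HasDerivAt (fun s ↦ (T - s)⁻¹ • G s y)
      ((T - t)⁻¹ • ((-2 : ℝ) • ricAt (G t) y) + (-(0 - 1) / (T - t) ^ 2) • G t y) t := h1.smul h2
  rw [h3.deriv, smul_sub, smul_smul, smul_smul]
  have hc1 : (T - t)⁻¹ * (-2 : ℝ) = -2 * (T - t)⁻¹ := by ring
  have hc2 : -(0 - 1) / (T - t) ^ 2 = -(-2 * (T - t)⁻¹ * (2 * (T - t))⁻¹) := by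
    field_simp
    ring
  rw [hc1, hc2, neg_smul, ← sub_eq_add_neg]

end Scaled

/-! ### Decay weights `(T − t)^{−δ}` in `SpatiallyBddUpTo` -/

section Weights

variable {W : Type*} [NormedAddCommGroup W] [NormedSpace ℝ W] {Ω : Set (E × ℝ)} {u : E × ℝ → W}

/-- **Order zero with a decay weight**: if `u` is `C^∞` on `Ω` (times in `(t₁, T)`) with
`‖u‖ ≤ C (T − t)^δ`, then `(T − t)^{−δ} u` is bounded (by `C`) up to order `0`. [folklore] -/
theorem spatiallyBddUpTo_zero_rpow_neg_smul (hu : ContDiffOn ℝ ∞ u Ω) {T t₁ δ C : ℝ}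
    (ht : ∀ q ∈ Ω, q.2 ∈ Ioo t₁ T) (hC : ∀ q ∈ Ω, ‖u q‖ ≤ C * (T - q.2) ^ δ) :
    SpatiallyBddUpTo Ω 0 (fun q ↦ (T - q.2) ^ (-δ) • u q) := by
  refine spatiallyBddUpTo_zero_iff.2 ⟨?_, C, fun q hq ↦ ?_⟩
  · have h1 : ContDiffOn ℝ ∞ (fun q : E × ℝ ↦ (T - q.2) ^ (-δ)) Ω := fun q hq ↦
      ((contDiffAt_rpow_sub (ht q hq).2 (-δ)).comp q contDiffAt_snd).contDiffWithinAt
    exact h1.smul hu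
  · have hpos : 0 < T - q.2 := sub_pos.2 (ht q hq).2
    have hp : 0 < (T - q.2) ^ δ := Real.rpow_pos_of_pos hpos δ
    rw [norm_smul, Real.norm_eq_abs, abs_of_nonneg (Real.rpow_nonneg hpos.le _),
      Real.rpow_neg hpos.le, inv_mul_le_iff₀ hp, mul_comm]
    exact hC q hq

/-- **A common positive rate** below `δ₀ > 0` and the first `N + 1` terms of a positive sequence.
[folklore] -/
theorem exists_pos_le_forall_le {δ₀ : ℝ} (hδ₀ : 0 < δ₀) {δ : ℕ → ℝ} (hδ : ∀ k, 0 < δ k) (N : ℕ) :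
    ∃ ε : ℝ, 0 < ε ∧ ε ≤ δ₀ ∧ ∀ k ≤ N, ε ≤ δ k := by
  induction N with
  | zero =>
    exact ⟨min δ₀ (δ 0), lt_min hδ₀ (hδ 0), min_le_left _ _, fun k hk ↦ by
      rw [Nat.le_zero.1 hk]; exact min_le_right _ _⟩
  | succ N ih =>
    obtain ⟨ε, hε, hε₀, hεk⟩ := ih
    refine ⟨min ε (δ (N + 1)), lt_min hε (hδ _), (min_le_left _ _).trans hε₀, fun k hk ↦ ?_⟩
    rcases Nat.of_le_succ hk with h | h
    · exact (min_le_left _ _).trans (hεk k h)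
    · rw [h]; exact min_le_right _ _

end Weights

end MetricCoord

end Literature.Geometry.Lorentzian

end
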